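import Summits.HodgeConjecture.HodgeConjecture.Theorems.F0P3cStCharTSRepHyperbolic          -- ★ p850107 REP-HYPERBOLIC (this seat): covered reps are hlevi-oriented; brings HORIENT, KIT-B, `E₂`∕`E₃` currency
import Summits.HodgeConjecture.HodgeConjecture.Theorems.F0P3cStCharTSDomGeneralHPkg         -- ★ p850025 (U2-C) DOM-GENERAL-H pkg (A-p16): `domGeneralH_of_levels`; brings ★ p849946 `coe_weylConj₂_eq_glDiagonal_rev`, `weylConj₂_mem_cmTorus`
import HarnessLib

/-!
# F0 · P3c · line LH6 «StCharTS» — road (D) «DEEP-FL», brick «FLIP-DOMINANT★»: the Weyl flip of a covered representative is H-DOMINANT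

Cell `pub/hodgecm-mathlib`, crux H413 = `stmt-HodgeConjecture-24833` (lane `--supports … --as helper`), route HCCMUnconditional; hand F0P3-p01 (g20) on the
road-(D) owner's deal (LH6-p04 (g3), 2026-09-02 07:13Z «TAKE FLIP-DOMINANT★»).  THEOREMS ONLY, sorry-free, ★-only imports; no definition ∕ instance ∕ notation ∕
named fact.  HONEST LABEL: HC_CM is proved only modulo the 7 printed citations (2 remaining: hLiu418 = stmt-HodgeConjecture-24832, h413 = stmt-HodgeConjecture-24833)
until rung 0 closes; count-neutral plumbing for the (D-c) head «XIG-ASSEMBLY».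

THE MATHEMATICS ([Rogawski1990, §1.10 p. 9; §4.9 Lemma 4.9.2 pp. 55–56; §12.7 L. 12.7.3 (proof) p. 195]).  `w₀ ∈ U(Φ₂)(L⁺_v)` a Weyl representative BY SHAPE (matrix `Φ₂`,
★ `F0P3cStCharTSDomGeneralH` ∕ ★ hF1H-ADAPTER).  By ★ REP-HYPERBOLIC a representative `u = (u₁, u₂)` of the coset cover COVERED by the oriented shell has `u₁ = diag(d′₀, d′₁)` with
`|(d′₁)_w| < |(d′₀)_w|` (hlevi-ORIENTED: first entry BIG).  Its Weyl flip `ʷu₁ = w₀ u₁ w₀⁻¹ = diag(d′₁, d′₀)` (★ `coe_weylConj₂_eq_glDiagonal_rev`) lies on `T₂`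
(★ `weylConj₂_mem_cmTorus`) and has `E₂(ʷu₁) = diag((d′₁)_w, (d′₀)_w)` with the FIRST entry SMALL — i.e. it is H-DOMINANT, exactly the input `(t, ht, hlt)` of ★ (U2-C)
`domGeneralH_of_levels` and the point `b := ʷu₁` (`hbM`) of ★ hF1H-ADAPTER `smoothTrace_cmPrincipalSeriesH_indicator_shell_eq_hF1H`; so ② HOH-SHELL-H applies at the flipped
representative, and ★ WEYL-FLIP-H p850009 relabels back.

* §1 the flip of an ORIENTED torus element: `glDiagonal_rev_eq_weylConj`, `localNonsplitEquiv_two_weylConj_eq_diagonal`, **`exists_eq_diagonal_weylConj_of_oriented`**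
  (`∃ e₀ e₁, E₂(ʷx₁) = diag(e₀, e₁) ∧ |e₀| < |e₁|` + `|e₀||e₁| = 1`, `σ_w e₁ · e₀ = 1`), `exists_glDiagonal_weylConj_of_oriented` (the `glDiagonal` reading);
* §2 **`flipDominant_of_mem_orientedShell`** (covered rep ⇒ `ʷu₁ ∈ T₂` ∧ dominant `E₂`-diagonal ∧ `glDiagonal` reading), **`forall_flipDominant_of_cover`** (over conjunct ① of
  ★ `exists_cosetCover`);
* §3 **`domGeneralH_weylConj_of_cover`** — ★ `domGeneralH_of_levels` AT THE FLIPPED REPRESENTATIVES: for every `u ∈ F`, F1-H's `hbN ∧ hbNbar ∧ hbexh` + `hR₂` at `b := ʷu₁`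
  (the (U2-C) level hypotheses carried VERBATIM).

## References
* [Rogawski1990] J. D. Rogawski, *Automorphic Representations of Unitary Groups in Three Variables*, Ann. of Math. Stud. 123 (1990): §1.10 p. 9; §4.9 Lemma 4.9.2
  pp. 55–56; §12.7 Lemma 12.7.3 (proof) p. 195.
* [Casselman1995] W. Casselman, *Introduction to the theory of admissible representations of 𝔭-adic reductive groups* (1995 notes), §1.4 Prop. 1.4.4 p. 14; §4.1.
-/

set_option autoImplicit false
-- the mandated namespace has the single-problem summit's repeated segment (`HodgeConjecture.HodgeConjecture`)
set_option linter.dupNamespace false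

noncomputable section

open Matrix NumberField IsDedekindDomain
open scoped MatrixGroups Pointwise
open Literature.NumberTheory Literature.NumberTheory.Rogawski1990 Literature.NumberTheory.Automorphic Literature.NumberTheory.Automorphic.UnitaryGroup
open Literature.NumberTheory.GaloisRepresentations
open ValuativeRel
open Summit.HodgeConjecture.HodgeConjecture.Cruxes.H413.F0P3cCMLocalNonsplitBorelTransportU2
open Summit.HodgeConjecture.HodgeConjecture.Cruxes.H413.F0P3cStCharTSDomGeneralH
open Summit.HodgeConjecture.HodgeConjecture.Cruxes.H413.F0P3cStCharTSRepHyperbolic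

namespace Summit.HodgeConjecture.HodgeConjecture.Cruxes.H413.F0P3cStCharTSFlipDominant

variable (L : Type) [Field L] [NumberField L] [IsCMField L] (v : HeightOneSpectrum (𝓞 ↥(maximalRealSubfield L)))
  (w : PlacesOver L v) (hw : IsCMField.complexConj L • w.1 = w.1)
  {w₀ : ↥(unitaryGroupOfForm (conjLocal L (IsCMField.complexConj L) v) (cmLocalForm L 2 v))}
  (hw₀ : Units.val (w₀ : GL (Fin 2) (LocalRing L v)) = cmLocalForm L 2 v)

/-! ## §1 The Weyl flip of an oriented element of `T₂` is dominant -/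

include hw₀ in
/-- **`glDiagonal (d′ ∘ rev) = ʷx₁`** for `x₁ = diag(d′₀, d′₁) ∈ T₂` (★ `coe_weylConj₂_eq_glDiagonal_rev`, oriented to KIT-B's `hd′` shape). [cite: Rogawski1990, §1.10 p. 9] -/
theorem glDiagonal_rev_eq_weylConj (x₁ : ↥(cmBorelTriple L 2 v).M) {d' : Fin 2 → (LocalRing L v)ˣ}
    (hd' : glDiagonal 2 (LocalRing L v) d' = ((x₁ : ↥(unitaryGroupOfForm (conjLocal L (IsCMField.complexConj L) v) (cmLocalForm L 2 v))) : GL (Fin 2) (LocalRing L v))) :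
    glDiagonal 2 (LocalRing L v) (fun i => d' i.rev) =
      ((w₀ * (x₁ : ↥(unitaryGroupOfForm (conjLocal L (IsCMField.complexConj L) v) (cmLocalForm L 2 v))) * w₀⁻¹ :
        ↥(unitaryGroupOfForm (conjLocal L (IsCMField.complexConj L) v) (cmLocalForm L 2 v))) : GL (Fin 2) (LocalRing L v)) :=
  (coe_weylConj₂_eq_glDiagonal_rev L v hw₀ hd').symm

include hw₀ in
/-- **`E₂(ʷx₁) = diag((d′₁)_w, (d′₀)_w)`** for `x₁ = diag(d′₀, d′₁) ∈ T₂`. [cite: Rogawski1990, §1.10 p. 9; §4.9 p. 55] -/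
theorem localNonsplitEquiv_two_weylConj_eq_diagonal (x₁ : ↥(cmBorelTriple L 2 v).M) {d' : Fin 2 → (LocalRing L v)ˣ}
    (hd' : glDiagonal 2 (LocalRing L v) d' = ((x₁ : ↥(unitaryGroupOfForm (conjLocal L (IsCMField.complexConj L) v) (cmLocalForm L 2 v))) : GL (Fin 2) (LocalRing L v))) :
    (((localNonsplitEquiv (IsCMField.complexConj L) (Matrix.of fun i j : Fin 2 => if i.val + j.val + 1 = 2 then (1 : L) else 0) (IsCMField.complexConj_ne_one L) w hw
          (w₀ * (x₁ : ↥(unitaryGroupOfForm (conjLocal L (IsCMField.complexConj L) v) (cmLocalForm L 2 v))) * w₀⁻¹) :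
        ↥(unitaryGroupOfForm (galAdicCompletionMap (L := L) (IsCMField.complexConj L) hw) (placeForm (Matrix.of fun i j : Fin 2 => if i.val + j.val + 1 = 2 then (1 : L) else 0) w.1))) :
        GL (Fin 2) (w.1.adicCompletion L)) : Matrix (Fin 2) (Fin 2) (w.1.adicCompletion L)) =
      Matrix.diagonal ![((d' 1 : (LocalRing L v)ˣ) : LocalRing L v) w, ((d' 0 : (LocalRing L v)ˣ) : LocalRing L v) w] :=
  localNonsplitEquiv_two_eq_diagonal_of_glDiagonal_eq L v w hw
    ⟨w₀ * (x₁ : ↥(unitaryGroupOfForm (conjLocal L (IsCMField.complexConj L) v) (cmLocalForm L 2 v))) * w₀⁻¹, weylConj₂_mem_cmTorus L v hw₀ x₁.2⟩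
    (glDiagonal_rev_eq_weylConj L v hw₀ x₁ hd')

include hw hw₀ in
/-- **THE FLIP OF AN ORIENTED ELEMENT IS DOMINANT, `E₂`-form**: `x₁ = diag(d′₀, d′₁) ∈ T₂` with `|(d′₁)_w| < |(d′₀)_w|` ⇒ `∃ e₀ e₁, E₂(ʷx₁) = diag(e₀, e₁) ∧ |e₀|_w < |e₁|_w`
(+ `|e₀||e₁| = 1`, `σ_w(e₁) · e₀ = 1`) — the `(ht, hlt)` input of ★ `domGeneralH_of_levels` at `t := ʷx₁`. [cite: Rogawski1990, §1.10 p. 9; §12.7 L. 12.7.3 (proof) p. 195] -/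
theorem exists_eq_diagonal_weylConj_of_oriented (x₁ : ↥(cmBorelTriple L 2 v).M) {d' : Fin 2 → (LocalRing L v)ˣ}
    (hd' : glDiagonal 2 (LocalRing L v) d' = ((x₁ : ↥(unitaryGroupOfForm (conjLocal L (IsCMField.complexConj L) v) (cmLocalForm L 2 v))) : GL (Fin 2) (LocalRing L v)))
    (hlt : Valued.v (((d' 1 : (LocalRing L v)ˣ) : LocalRing L v) w) < Valued.v (((d' 0 : (LocalRing L v)ˣ) : LocalRing L v) w)) :
    ∃ e₀ e₁ : w.1.adicCompletion L,
      (((localNonsplitEquiv (IsCMField.complexConj L) (Matrix.of fun i j : Fin 2 => if i.val + j.val + 1 = 2 then (1 : L) else 0) (IsCMField.complexConj_ne_one L) w hw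
            (w₀ * (x₁ : ↥(unitaryGroupOfForm (conjLocal L (IsCMField.complexConj L) v) (cmLocalForm L 2 v))) * w₀⁻¹) :
          ↥(unitaryGroupOfForm (galAdicCompletionMap (L := L) (IsCMField.complexConj L) hw) (placeForm (Matrix.of fun i j : Fin 2 => if i.val + j.val + 1 = 2 then (1 : L) else 0) w.1))) :
          GL (Fin 2) (w.1.adicCompletion L)) : Matrix (Fin 2) (Fin 2) (w.1.adicCompletion L)) = Matrix.diagonal ![e₀, e₁] ∧
      Valued.v e₀ < Valued.v e₁ ∧ Valued.v e₀ * Valued.v e₁ = 1 ∧ galAdicCompletionMap (L := L) (IsCMField.complexConj L) hw e₁ * e₀ = 1 := by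
  refine ⟨((d' 1 : (LocalRing L v)ˣ) : LocalRing L v) w, ((d' 0 : (LocalRing L v)ˣ) : LocalRing L v) w,
    localNonsplitEquiv_two_weylConj_eq_diagonal L v w hw hw₀ x₁ hd', hlt, ?_, conj_apply_mul_apply_eq_one_of_glDiagonal_eq L v w hw x₁ hd'⟩
  rw [mul_comm]
  exact valued_apply_mul_valued_apply_eq_one_of_glDiagonal_eq L v w hw x₁ hd'

include hw hw₀ in
/-- The same in the `glDiagonal` ∕ KIT-B reading: `ʷx₁ ∈ T₂` and `∃ d″, glDiagonal d″ = ʷx₁ ∧ |(d″₀)_w| < |(d″₁)_w| ∧ σ_w((d″₀)_w)(d″₁)_w = 1` (`d″ = (d′₁, d′₀)`; the last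
clause is the torus relation `σ(d′₁) d′₀ = 1` of ★ `LineRing.torus_relations_two` read at `w`). [cite: Rogawski1990, §1.10 p. 9; §12.7 L. 12.7.3 (proof) p. 195] -/
theorem exists_glDiagonal_weylConj_of_oriented (x₁ : ↥(cmBorelTriple L 2 v).M) {d' : Fin 2 → (LocalRing L v)ˣ}
    (hd' : glDiagonal 2 (LocalRing L v) d' = ((x₁ : ↥(unitaryGroupOfForm (conjLocal L (IsCMField.complexConj L) v) (cmLocalForm L 2 v))) : GL (Fin 2) (LocalRing L v)))
    (hlt : Valued.v (((d' 1 : (LocalRing L v)ˣ) : LocalRing L v) w) < Valued.v (((d' 0 : (LocalRing L v)ˣ) : LocalRing L v) w)) :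
    w₀ * (x₁ : ↥(unitaryGroupOfForm (conjLocal L (IsCMField.complexConj L) v) (cmLocalForm L 2 v))) * w₀⁻¹ ∈ (cmBorelTriple L 2 v).M ∧
    ∃ d'' : Fin 2 → (LocalRing L v)ˣ,
      glDiagonal 2 (LocalRing L v) d'' =
        ((w₀ * (x₁ : ↥(unitaryGroupOfForm (conjLocal L (IsCMField.complexConj L) v) (cmLocalForm L 2 v))) * w₀⁻¹ :
          ↥(unitaryGroupOfForm (conjLocal L (IsCMField.complexConj L) v) (cmLocalForm L 2 v))) : GL (Fin 2) (LocalRing L v)) ∧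
      Valued.v (((d'' 0 : (LocalRing L v)ˣ) : LocalRing L v) w) < Valued.v (((d'' 1 : (LocalRing L v)ˣ) : LocalRing L v) w) ∧
      galAdicCompletionMap (L := L) (IsCMField.complexConj L) hw (((d'' 0 : (LocalRing L v)ˣ) : LocalRing L v) w) * ((d'' 1 : (LocalRing L v)ˣ) : LocalRing L v) w = 1 := by
  have hmem := weylConj₂_mem_cmTorus L v hw₀ x₁.2
  have hrev : (fun i : Fin 2 => d' i.rev) = ![d' 1, d' 0] := by
    funext i
    fin_cases i <;> rfl
  have hgl := glDiagonal_rev_eq_weylConj L v hw₀ x₁ hd'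
  rw [hrev] at hgl
  -- the torus relation `σ(d′₁) d′₀ = 1` read at `w`
  obtain ⟨h10, -⟩ := LineRing.torus_relations_two (conjLocal L (IsCMField.complexConj L) v) (cmLocalForm_eq_over L 2 v) x₁ hd'
  have h10w := congrArg (fun y : LocalRing L v => y w) h10
  simp only [Pi.mul_apply, Pi.one_apply] at h10w
  rw [conjLocal_apply_eq_galAdicCompletionMap L v w hw] at h10w
  refine ⟨hmem, ![d' 1, d' 0], hgl, ?_, ?_⟩
  · simpa only [Matrix.cons_val_zero, Matrix.cons_val_one, Matrix.head_cons] using hlt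
  · simpa only [Matrix.cons_val_zero, Matrix.cons_val_one, Matrix.head_cons] using h10w

/-! ## §2 Covered representatives of the oriented shell: their flips are dominant -/

include hw hw₀ in
/-- **«FLIP-DOMINANT★» for ONE covered representative** `x = (x₁, x₂)` of the ORIENTED shell `b′·S_n` (hypotheses of ★ REP-HYPERBOLIC `valued_lt_of_mem_orientedShell` VERBATIM):
`ʷx₁ ∈ T₂`, the dominant `E₂`-diagonal `∃ e₀ e₁, E₂(ʷx₁) = diag(e₀, e₁) ∧ |e₀| < |e₁| ∧ |e₀||e₁| = 1 ∧ σ_w e₁ · e₀ = 1`, and the `glDiagonal` reading.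
[cite: Rogawski1990, §4.9 Lemma 4.9.2 pp. 55–56; §12.7 L. 12.7.3 (proof) p. 195] [cite: Casselman1995, §1.4 Prop. 1.4.4 p. 14] -/
theorem flipDominant_of_mem_orientedShell
    (Kn : Subgroup ↥(unitaryGroupOfForm (conjLocal L (IsCMField.complexConj L) v) (cmLocalForm L 3 v))) {r : WithZero (Multiplicative ℤ)} (hr : r < 1)
    (hK : ∀ k ∈ Kn, ∀ i j, Valued.v ((((localNonsplitEquiv (IsCMField.complexConj L) (qsForm L) (IsCMField.complexConj_ne_one L) w hw k :
        ↥(unitaryGroupOfForm (galAdicCompletionMap (L := L) (IsCMField.complexConj L) hw) (placeForm (qsForm L) w.1))) :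
        GL (Fin 3) (w.1.adicCompletion L)) : Matrix (Fin 3) (Fin 3) (w.1.adicCompletion L)) i j - (1 : Matrix (Fin 3) (Fin 3) (w.1.adicCompletion L)) i j) ≤ r)
    {b' : ↥(cmBorelTriple L 3 v).M} {e₀ e₁ e₂ : w.1.adicCompletion L}
    (hb' : (((localNonsplitEquiv (IsCMField.complexConj L) (qsForm L) (IsCMField.complexConj_ne_one L) w hw
          (b' : ↥(unitaryGroupOfForm (conjLocal L (IsCMField.complexConj L) v) (cmLocalForm L 3 v))) :
        ↥(unitaryGroupOfForm (galAdicCompletionMap (L := L) (IsCMField.complexConj L) hw) (placeForm (qsForm L) w.1))) :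
        GL (Fin 3) (w.1.adicCompletion L)) : Matrix (Fin 3) (Fin 3) (w.1.adicCompletion L)) = Matrix.diagonal ![e₀, e₁, e₂])
    (he : Valued.v e₂ < Valued.v e₀)
    (Sn : Subgroup ↥(cmBorelTriple L 3 v).M)
    (hSn : ∀ s ∈ Sn, ((s : ↥(cmBorelTriple L 3 v).M) : ↥(unitaryGroupOfForm (conjLocal L (IsCMField.complexConj L) v) (cmLocalForm L 3 v))) ∈ Kn)
    (x : ↥(cmBorelTriple L 2 v).M × (cmDatum L 1 (Matrix.of fun i j : Fin 1 => if i.val + j.val + 1 = 1 then (1 : L) else 0)).Local v)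
    {t : ↥(cmBorelTriple L 3 v).M} (ht : t ∈ b' • (Sn : Set ↥(cmBorelTriple L 3 v).M))
    (hxt : (t : ↥(unitaryGroupOfForm (conjLocal L (IsCMField.complexConj L) v) (cmLocalForm L 3 v))) =
      endoEmbLocal L v ((x.1 : ↥(unitaryGroupOfForm (conjLocal L (IsCMField.complexConj L) v) (cmLocalForm L 2 v))), x.2)) :
    w₀ * (x.1 : ↥(unitaryGroupOfForm (conjLocal L (IsCMField.complexConj L) v) (cmLocalForm L 2 v))) * w₀⁻¹ ∈ (cmBorelTriple L 2 v).M ∧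
    (∃ e₀' e₁' : w.1.adicCompletion L,
      (((localNonsplitEquiv (IsCMField.complexConj L) (Matrix.of fun i j : Fin 2 => if i.val + j.val + 1 = 2 then (1 : L) else 0) (IsCMField.complexConj_ne_one L) w hw
            (w₀ * (x.1 : ↥(unitaryGroupOfForm (conjLocal L (IsCMField.complexConj L) v) (cmLocalForm L 2 v))) * w₀⁻¹) :
          ↥(unitaryGroupOfForm (galAdicCompletionMap (L := L) (IsCMField.complexConj L) hw) (placeForm (Matrix.of fun i j : Fin 2 => if i.val + j.val + 1 = 2 then (1 : L) else 0) w.1))) :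
          GL (Fin 2) (w.1.adicCompletion L)) : Matrix (Fin 2) (Fin 2) (w.1.adicCompletion L)) = Matrix.diagonal ![e₀', e₁'] ∧
      Valued.v e₀' < Valued.v e₁' ∧ Valued.v e₀' * Valued.v e₁' = 1 ∧ galAdicCompletionMap (L := L) (IsCMField.complexConj L) hw e₁' * e₀' = 1) ∧
    (∃ d'' : Fin 2 → (LocalRing L v)ˣ,
      glDiagonal 2 (LocalRing L v) d'' =
        ((w₀ * (x.1 : ↥(unitaryGroupOfForm (conjLocal L (IsCMField.complexConj L) v) (cmLocalForm L 2 v))) * w₀⁻¹ :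
          ↥(unitaryGroupOfForm (conjLocal L (IsCMField.complexConj L) v) (cmLocalForm L 2 v))) : GL (Fin 2) (LocalRing L v)) ∧
      Valued.v (((d'' 0 : (LocalRing L v)ˣ) : LocalRing L v) w) < Valued.v (((d'' 1 : (LocalRing L v)ˣ) : LocalRing L v) w) ∧
      galAdicCompletionMap (L := L) (IsCMField.complexConj L) hw (((d'' 0 : (LocalRing L v)ˣ) : LocalRing L v) w) * ((d'' 1 : (LocalRing L v)ˣ) : LocalRing L v) w = 1) := by
  obtain ⟨d', hd', hlt, -⟩ := exists_glDiagonal_of_mem_orientedShell L v w hw Kn hr hK hb' he Sn hSn x ht hxt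
  obtain ⟨hmem, hgl⟩ := exists_glDiagonal_weylConj_of_oriented L v w hw hw₀ x.1 hd' hlt
  exact ⟨hmem, exists_eq_diagonal_weylConj_of_oriented L v w hw hw₀ x.1 hd' hlt, hgl⟩

include hw hw₀ in
/-- **«FLIP-DOMINANT★» OVER THE COVER** (conjunct ① of ★ `F0P3cStCharTSCosetCover.exists_cosetCover` VERBATIM): for every `u ∈ F`, `ʷu₁ ∈ T₂`, the dominant `E₂`-diagonal of `ʷu₁`, and
the `glDiagonal` reading. [cite: Rogawski1990, §4.9 Lemma 4.9.2 pp. 55–56; §12.7 L. 12.7.3 (proof) p. 195] [cite: Casselman1995, §1.4 Prop. 1.4.4 p. 14] -/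
theorem forall_flipDominant_of_cover
    (Kn : Subgroup ↥(unitaryGroupOfForm (conjLocal L (IsCMField.complexConj L) v) (cmLocalForm L 3 v))) {r : WithZero (Multiplicative ℤ)} (hr : r < 1)
    (hK : ∀ k ∈ Kn, ∀ i j, Valued.v ((((localNonsplitEquiv (IsCMField.complexConj L) (qsForm L) (IsCMField.complexConj_ne_one L) w hw k :
        ↥(unitaryGroupOfForm (galAdicCompletionMap (L := L) (IsCMField.complexConj L) hw) (placeForm (qsForm L) w.1))) :
        GL (Fin 3) (w.1.adicCompletion L)) : Matrix (Fin 3) (Fin 3) (w.1.adicCompletion L)) i j - (1 : Matrix (Fin 3) (Fin 3) (w.1.adicCompletion L)) i j) ≤ r)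
    {b' : ↥(cmBorelTriple L 3 v).M} {e₀ e₁ e₂ : w.1.adicCompletion L}
    (hb' : (((localNonsplitEquiv (IsCMField.complexConj L) (qsForm L) (IsCMField.complexConj_ne_one L) w hw
          (b' : ↥(unitaryGroupOfForm (conjLocal L (IsCMField.complexConj L) v) (cmLocalForm L 3 v))) :
        ↥(unitaryGroupOfForm (galAdicCompletionMap (L := L) (IsCMField.complexConj L) hw) (placeForm (qsForm L) w.1))) :
        GL (Fin 3) (w.1.adicCompletion L)) : Matrix (Fin 3) (Fin 3) (w.1.adicCompletion L)) = Matrix.diagonal ![e₀, e₁, e₂])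
    (he : Valued.v e₂ < Valued.v e₀)
    (Sn : Subgroup ↥(cmBorelTriple L 3 v).M)
    (hSn : ∀ s ∈ Sn, ((s : ↥(cmBorelTriple L 3 v).M) : ↥(unitaryGroupOfForm (conjLocal L (IsCMField.complexConj L) v) (cmLocalForm L 3 v))) ∈ Kn)
    (F : Finset (↥(cmBorelTriple L 2 v).M × (cmDatum L 1 (Matrix.of fun i j : Fin 1 => if i.val + j.val + 1 = 1 then (1 : L) else 0)).Local v))
    (hF : ∀ u ∈ F, ∃ t ∈ b' • (Sn : Set ↥(cmBorelTriple L 3 v).M),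
      (t : ↥(unitaryGroupOfForm (conjLocal L (IsCMField.complexConj L) v) (cmLocalForm L 3 v))) =
        endoEmbLocal L v ((u.1 : ↥(unitaryGroupOfForm (conjLocal L (IsCMField.complexConj L) v) (cmLocalForm L 2 v))), u.2)) :
    ∀ u ∈ F,
      w₀ * (u.1 : ↥(unitaryGroupOfForm (conjLocal L (IsCMField.complexConj L) v) (cmLocalForm L 2 v))) * w₀⁻¹ ∈ (cmBorelTriple L 2 v).M ∧
      (∃ e₀' e₁' : w.1.adicCompletion L,
        (((localNonsplitEquiv (IsCMField.complexConj L) (Matrix.of fun i j : Fin 2 => if i.val + j.val + 1 = 2 then (1 : L) else 0) (IsCMField.complexConj_ne_one L) w hw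
              (w₀ * (u.1 : ↥(unitaryGroupOfForm (conjLocal L (IsCMField.complexConj L) v) (cmLocalForm L 2 v))) * w₀⁻¹) :
            ↥(unitaryGroupOfForm (galAdicCompletionMap (L := L) (IsCMField.complexConj L) hw) (placeForm (Matrix.of fun i j : Fin 2 => if i.val + j.val + 1 = 2 then (1 : L) else 0) w.1))) :
            GL (Fin 2) (w.1.adicCompletion L)) : Matrix (Fin 2) (Fin 2) (w.1.adicCompletion L)) = Matrix.diagonal ![e₀', e₁'] ∧
        Valued.v e₀' < Valued.v e₁' ∧ Valued.v e₀' * Valued.v e₁' = 1 ∧ galAdicCompletionMap (L := L) (IsCMField.complexConj L) hw e₁' * e₀' = 1) ∧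
      (∃ d'' : Fin 2 → (LocalRing L v)ˣ,
        glDiagonal 2 (LocalRing L v) d'' =
          ((w₀ * (u.1 : ↥(unitaryGroupOfForm (conjLocal L (IsCMField.complexConj L) v) (cmLocalForm L 2 v))) * w₀⁻¹ :
            ↥(unitaryGroupOfForm (conjLocal L (IsCMField.complexConj L) v) (cmLocalForm L 2 v))) : GL (Fin 2) (LocalRing L v)) ∧
        Valued.v (((d'' 0 : (LocalRing L v)ˣ) : LocalRing L v) w) < Valued.v (((d'' 1 : (LocalRing L v)ˣ) : LocalRing L v) w) ∧
        galAdicCompletionMap (L := L) (IsCMField.complexConj L) hw (((d'' 0 : (LocalRing L v)ˣ) : LocalRing L v) w) * ((d'' 1 : (LocalRing L v)ˣ) : LocalRing L v) w = 1) := by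
  intro u hu
  obtain ⟨t, ht, htu⟩ := hF u hu
  exact flipDominant_of_mem_orientedShell L v w hw hw₀ Kn hr hK hb' he Sn hSn u ht htu

/-! ## §3 ★ (U2-C) `domGeneralH_of_levels` at the flipped representatives -/

include hw₀ in
/-- **F1-H's DOMINANCE PACKAGE AT `b := ʷu₁` FOR EVERY COVERED REPRESENTATIVE.**  The (U2-C) level data of ★ `domGeneralH_of_levels` VERBATIM (`γ₀`, `𝓘`, `𝓘′`, `hNbar′`, `hK′`, `hK`,
`hNbar`, `n`) + the oriented-shell data of ★ REP-HYPERBOLIC + conjunct ① of ★ `exists_cosetCover` ⇒ for every `u ∈ F`: `hbN ∧ hbNbar ∧ hbexh ∧ (∃ R₂, hR₂)` at `b := w₀ u₁ w₀⁻¹`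
(the four binders of ★ hF1H-ADAPTER ∕ ★ F1-H p849597; `hbM` is `forall_flipDominant_of_cover … |>.1`). [cite: Casselman1995, §1.4 Prop. 1.4.4 p. 14; §4.1]
[cite: Rogawski1990, §12.7 L. 12.7.3 (proof) p. 195] -/
theorem domGeneralH_weylConj_of_cover {γ₀ : ValueGroupWithZero (w.1.adicCompletion L)} (hγ₀0 : γ₀ ≠ 0) (hγ₀1 : γ₀ < 1)
    (𝓘 : (cmBorelTriple L 2 v).IwahoriDatum)
    (𝓘' : (borelTriple (galAdicCompletionMap (L := L) (IsCMField.complexConj L) hw)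
      (placeForm (Matrix.of fun i j : Fin 2 => if i.val + j.val + 1 = 2 then (1 : L) else 0) w.1) (placeForm_antidiagTwo_eq L v w)).IwahoriDatum)
    (hNbar' : 𝓘'.Nbar = ((borelTriple (galAdicCompletionMap (L := L) (IsCMField.complexConj L) hw)
      (placeForm (Matrix.of fun i j : Fin 2 => if i.val + j.val + 1 = 2 then (1 : L) else 0) w.1) (placeForm_antidiagTwo_eq L v w)).N).map
        (MulAut.conj (weylLongU (galAdicCompletionMap (L := L) (IsCMField.complexConj L) hw) (placeForm_antidiagTwo_eq L v w))).toMonoidHom)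
    (hK' : ∀ j : ℕ, 𝓘'.K j = (congruenceGL 2 (γ₀ ^ (j + 1))).comap (unitaryGroupOfForm (galAdicCompletionMap (L := L) (IsCMField.complexConj L) hw)
      (placeForm (Matrix.of fun i j : Fin 2 => if i.val + j.val + 1 = 2 then (1 : L) else 0) w.1)).subtype)
    (hK𝓘 : ∀ n, 𝓘.K n = (𝓘'.K n).comap
        (localNonsplitEquiv (IsCMField.complexConj L) (Matrix.of fun i j : Fin 2 => if i.val + j.val + 1 = 2 then (1 : L) else 0)
            (IsCMField.complexConj_ne_one L) w hw :
          «local» L (IsCMField.complexConj L) 2 (Matrix.of fun i j : Fin 2 => if i.val + j.val + 1 = 2 then (1 : L) else 0) v →*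
            ↥(unitaryGroupOfForm (galAdicCompletionMap (L := L) (IsCMField.complexConj L) hw)
              (placeForm (Matrix.of fun i j : Fin 2 => if i.val + j.val + 1 = 2 then (1 : L) else 0) w.1))))
    (hNbar : 𝓘.Nbar = 𝓘'.Nbar.comap
        (localNonsplitEquiv (IsCMField.complexConj L) (Matrix.of fun i j : Fin 2 => if i.val + j.val + 1 = 2 then (1 : L) else 0)
            (IsCMField.complexConj_ne_one L) w hw :
          «local» L (IsCMField.complexConj L) 2 (Matrix.of fun i j : Fin 2 => if i.val + j.val + 1 = 2 then (1 : L) else 0) v →*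
            ↥(unitaryGroupOfForm (galAdicCompletionMap (L := L) (IsCMField.complexConj L) hw)
              (placeForm (Matrix.of fun i j : Fin 2 => if i.val + j.val + 1 = 2 then (1 : L) else 0) w.1))))
    (n : ℕ)
    (Kn : Subgroup ↥(unitaryGroupOfForm (conjLocal L (IsCMField.complexConj L) v) (cmLocalForm L 3 v))) {r : WithZero (Multiplicative ℤ)} (hr : r < 1)
    (hK : ∀ k ∈ Kn, ∀ i j, Valued.v ((((localNonsplitEquiv (IsCMField.complexConj L) (qsForm L) (IsCMField.complexConj_ne_one L) w hw k :
        ↥(unitaryGroupOfForm (galAdicCompletionMap (L := L) (IsCMField.complexConj L) hw) (placeForm (qsForm L) w.1))) :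
        GL (Fin 3) (w.1.adicCompletion L)) : Matrix (Fin 3) (Fin 3) (w.1.adicCompletion L)) i j - (1 : Matrix (Fin 3) (Fin 3) (w.1.adicCompletion L)) i j) ≤ r)
    {b' : ↥(cmBorelTriple L 3 v).M} {e₀ e₁ e₂ : w.1.adicCompletion L}
    (hb' : (((localNonsplitEquiv (IsCMField.complexConj L) (qsForm L) (IsCMField.complexConj_ne_one L) w hw
          (b' : ↥(unitaryGroupOfForm (conjLocal L (IsCMField.complexConj L) v) (cmLocalForm L 3 v))) :
        ↥(unitaryGroupOfForm (galAdicCompletionMap (L := L) (IsCMField.complexConj L) hw) (placeForm (qsForm L) w.1))) :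
        GL (Fin 3) (w.1.adicCompletion L)) : Matrix (Fin 3) (Fin 3) (w.1.adicCompletion L)) = Matrix.diagonal ![e₀, e₁, e₂])
    (he : Valued.v e₂ < Valued.v e₀)
    (Sn : Subgroup ↥(cmBorelTriple L 3 v).M)
    (hSn : ∀ s ∈ Sn, ((s : ↥(cmBorelTriple L 3 v).M) : ↥(unitaryGroupOfForm (conjLocal L (IsCMField.complexConj L) v) (cmLocalForm L 3 v))) ∈ Kn)
    (F : Finset (↥(cmBorelTriple L 2 v).M × (cmDatum L 1 (Matrix.of fun i j : Fin 1 => if i.val + j.val + 1 = 1 then (1 : L) else 0)).Local v))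
    (hF : ∀ u ∈ F, ∃ t ∈ b' • (Sn : Set ↥(cmBorelTriple L 3 v).M),
      (t : ↥(unitaryGroupOfForm (conjLocal L (IsCMField.complexConj L) v) (cmLocalForm L 3 v))) =
        endoEmbLocal L v ((u.1 : ↥(unitaryGroupOfForm (conjLocal L (IsCMField.complexConj L) v) (cmLocalForm L 2 v))), u.2)) :
    ∀ u ∈ F,
      (∀ x ∈ 𝓘.K n ⊓ (cmBorelTriple L 2 v).N,
        (w₀ * (u.1 : ↥(unitaryGroupOfForm (conjLocal L (IsCMField.complexConj L) v) (cmLocalForm L 2 v))) * w₀⁻¹) * x *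
          (w₀ * (u.1 : ↥(unitaryGroupOfForm (conjLocal L (IsCMField.complexConj L) v) (cmLocalForm L 2 v))) * w₀⁻¹)⁻¹ ∈ 𝓘.K n) ∧
      (∀ x ∈ 𝓘.K n ⊓ 𝓘.Nbar,
        (w₀ * (u.1 : ↥(unitaryGroupOfForm (conjLocal L (IsCMField.complexConj L) v) (cmLocalForm L 2 v))) * w₀⁻¹)⁻¹ * x *
          (w₀ * (u.1 : ↥(unitaryGroupOfForm (conjLocal L (IsCMField.complexConj L) v) (cmLocalForm L 2 v))) * w₀⁻¹) ∈ 𝓘.K n ⊓ 𝓘.Nbar) ∧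
      (∀ x ∈ (cmBorelTriple L 2 v).N, ∃ m : ℕ, ∀ m', m ≤ m' →
        (w₀ * (u.1 : ↥(unitaryGroupOfForm (conjLocal L (IsCMField.complexConj L) v) (cmLocalForm L 2 v))) * w₀⁻¹) ^ m' * x *
          ((w₀ * (u.1 : ↥(unitaryGroupOfForm (conjLocal L (IsCMField.complexConj L) v) (cmLocalForm L 2 v))) * w₀⁻¹) ^ m')⁻¹ ∈ 𝓘.K n) ∧
      (∃ R₂ : Finset ↥(unitaryGroupOfForm (conjLocal L (IsCMField.complexConj L) v) (cmLocalForm L 2 v)),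
        IsLeftTransversal (𝓘.K n) (𝓘.K n ⊓ ConjAct.toConjAct (w₀ * (u.1 : ↥(unitaryGroupOfForm (conjLocal L (IsCMField.complexConj L) v) (cmLocalForm L 2 v))) * w₀⁻¹) • 𝓘.K n) R₂) := by
  intro u hu
  obtain ⟨-, ⟨e₀', e₁', hE, hlt, -, -⟩, -⟩ := forall_flipDominant_of_cover L v w hw hw₀ Kn hr hK hb' he Sn hSn F hF u hu
  exact F0P3cStCharTSDomGeneralHPkg.domGeneralH_of_levels L v w hw hγ₀0 hγ₀1 𝓘 𝓘' hNbar' hK' hK𝓘 hNbar n _ hE hlt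

end Summit.HodgeConjecture.HodgeConjecture.Cruxes.H413.F0P3cStCharTSFlipDominant

end
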